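import Literature.NumberTheory.Automorphic.LocalUnitaryGroupCongrInner          -- ★ `conj_eq_conj_of_eq_mul_scalar`, `formCongr_*` algebra, `cmDatumLocalCongr` (via LocalUnitaryGroupCongr)
import Literature.NumberTheory.Automorphic.IrreducibleClassesComapInner          -- ★ `IrrClass.comap_eq_comap_of_forall_eq_conj`
import HarnessLib

/-!
# R90-TF · S4 (Ch. 13.1–2) · hand p04 — (F2a) two local similitudes of `Φ_N` whose multipliers differ by a NORM `z̄z` induce THE SAME
# pull-back `Irr(U(Φ_N)(L⁺_v)) → Irr(U(Φ_N)(L⁺_v))` (they differ by an inner automorphism and a central scalar)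

Cell `hodgecm-mathlib`, crux H413 (`stmt-HodgeConjecture-24833`), route of record `HCCMUnconditional`; programme R90-TF (brief
`director/R90-BRIEF.v2.md` 1f40d54518340a35), section S4 = Rogawski Ch. 13.1–2 (base `R90-C131`), seat R90-C131-p04 (g0), socket S4#B3
`R90.S4.stub_R90_S4_H_cover` (`Cruxes/H413/Lines/R90_S4_HPacketsU2B.lean` :338) ROAD «SCHUR ⊠-SPLITTING + FINITE ORBIT», step (F2a) of the
orbit-finiteness half (also the «inner similitudes fix the class» input of S4#B4 `_card`, hand p03: take `T₁ = 1`).  Lane `--supports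
stmt-HodgeConjecture-24833 --as helper`; ONE public theorem, no definition, no instance, no notation, no `sorry`.

THE MATHEMATICS ([Rogawski1990, §11.1 p. 161: «An L-packet on `G = U(2)` is a `PGL₂(F)`-orbit»; Lemma 3.5.3 p. 28]; [PlatonovRapinchuk1994, §2.3]).
The `G_ad(F)`-action on `Irr(U(Φ_N)(L⁺_v))` is realised in file B by conjugation by similitudes `T ∈ GL_N(L ⊗ L⁺_v)`, `ᵗT̄ Φ_N T = a Φ_N`
(★ `cmDatumLocalCongr`, ★ `IrrClass.comap`).  If `T₁, T₂` are similitudes with `a₂ = (z̄ z) · a₁` for a unit `z` of `L ⊗ L⁺_v`, then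
`S := T₁⁻¹ T₂` is a similitude with multiplier `z̄ z`, so `u := S · (z • 1)⁻¹` is UNITARY and `T₂ = T₁ · u · (z • 1)`: conjugation by `T₂` is
conjugation by `T₁` composed with the INNER automorphism `Ad(u)` of `U(Φ_N)(L⁺_v)` (the scalar is central).  An inner automorphism pulls every
irreducible class back to itself (`π(u)` intertwines, ★ `IrrClass.comap_eq_comap_of_forall_eq_conj`), hence
`IrrClass.comap (e_{T₂}) = IrrClass.comap (e_{T₁})`.  So the orbit of a class under ALL similitudes is the orbit under any set of similitudes
representing the multipliers modulo norms — finite (hand p04, next file) and of size `≤ [F^× : N E^×] ≤ 2` (hand p03).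

HONEST LABEL: HC_CM is proved only modulo the 7 printed citations (2 remaining named inputs: hLiu418 = stmt-HodgeConjecture-24832, h413 =
stmt-HodgeConjecture-24833) until rung 0 closes; this file is local group theory + ★ plumbing and discharges none of them.  REL ≠ ★ ≠ BUILT.

## References
* [Rogawski1990] J. D. Rogawski, *Automorphic Representations of Unitary Groups in Three Variables*, Ann. of Math. Stud. 123 (1990), §11.1 p. 161,
  §3.5 Lemma 3.5.3 p. 28, §14.2 p. 234.
* [PlatonovRapinchuk1994] V. Platonov, A. Rapinchuk, *Algebraic Groups and Number Theory* (1994), §2.3.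
* [BushnellHenniart2006] C. J. Bushnell, G. Henniart, *The Local Langlands Conjecture for GL(2)* (2006), §1.1.
-/

set_option autoImplicit false
set_option linter.dupNamespace false

noncomputable section

open NumberField IsDedekindDomain
open scoped Matrix MatrixGroups
open Literature.NumberTheory.Automorphic Literature.NumberTheory.Automorphic.UnitaryGroup

namespace Summit.HodgeConjecture.HodgeConjecture.R90.S4

variable (L : Type) [Field L] [NumberField L] [IsCMField L] {N : ℕ} (v : HeightOneSpectrum (𝓞 ↥(maximalRealSubfield L)))

/-- **(F2a) Similitudes of `Φ_N` with multipliers in the same NORM CLASS give the same pull-back on `Irr(U(Φ_N)(L⁺_v))`.**  For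
`ᵗT̄ᵢ · (Φ_N)_v · Tᵢ = aᵢ • (Φ_N)_v` (`aᵢ` units, `i = 1, 2`) with `a₂ = (z̄ · z) · a₁` for a unit `z` of `L ⊗ L⁺_v`:
`IrrClass.comap (cmDatumLocalCongr L v T₂ …) c = IrrClass.comap (cmDatumLocalCongr L v T₁ …) c` for every class `c` — `T₁⁻¹ T₂ = u · (z • 1)`
with `u ∈ U(Φ_N)(L⁺_v)`, and `Ad(u)` fixes every class.  (With `T₁ = 1`: an INNER similitude, or one with NORM multiplier, fixes every class.)
[cite: Rogawski1990, §11.1 p. 161; §3.5 Lemma 3.5.3 p. 28; §14.2 p. 234] [cite: PlatonovRapinchuk1994, §2.3] -/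
theorem comap_cmDatumLocalCongr_eq_of_norm (T₁ T₂ : GL (Fin N) (LocalRing L v)) {a₁ a₂ : LocalRing L v} (ha₁ : IsUnit a₁) (ha₂ : IsUnit a₂)
    (h₁ : formCongr (conjLocal L (IsCMField.complexConj L) v) T₁
        ((Matrix.of fun i j : Fin N => if i.val + j.val + 1 = N then (1 : L) else 0).map (algebraMap L (LocalRing L v))) =
      a₁ • (Matrix.of fun i j : Fin N => if i.val + j.val + 1 = N then (1 : L) else 0).map (algebraMap L (LocalRing L v)))
    (h₂ : formCongr (conjLocal L (IsCMField.complexConj L) v) T₂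
        ((Matrix.of fun i j : Fin N => if i.val + j.val + 1 = N then (1 : L) else 0).map (algebraMap L (LocalRing L v))) =
      a₂ • (Matrix.of fun i j : Fin N => if i.val + j.val + 1 = N then (1 : L) else 0).map (algebraMap L (LocalRing L v)))
    (z : (LocalRing L v)ˣ) (hz : a₂ = conjLocal L (IsCMField.complexConj L) v z * z * a₁)
    (c : IrrClass ((cmDatum L N (Matrix.of fun i j : Fin N => if i.val + j.val + 1 = N then (1 : L) else 0)).Local v)) :
    IrrClass.comap (cmDatumLocalCongr L v T₂ ha₂ h₂) c = IrrClass.comap (cmDatumLocalCongr L v T₁ ha₁ h₁) c := by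
  set σ := conjLocal L (IsCMField.complexConj L) v with hσdef
  set Φv : Matrix (Fin N) (Fin N) (LocalRing L v) :=
    (Matrix.of fun i j : Fin N => if i.val + j.val + 1 = N then (1 : L) else 0).map (algebraMap L (LocalRing L v)) with hΦvdef
  -- the similitude `S = T₁⁻¹ T₂` of `Φ_N` with multiplier `a₁⁻¹ a₂ = σ z * z`
  have hback : formCongr σ T₁⁻¹ Φv = (↑ha₁.unit⁻¹ : LocalRing L v) • Φv := by
    have e1 : formCongr σ T₁⁻¹ (a₁ • Φv) = Φv := by rw [← h₁, formCongr_inv_formCongr]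
    rw [formCongr_smul_eq] at e1
    calc formCongr σ T₁⁻¹ Φv = ((↑ha₁.unit⁻¹ : LocalRing L v) * a₁) • formCongr σ T₁⁻¹ Φv := by rw [ha₁.val_inv_mul, one_smul]
      _ = (↑ha₁.unit⁻¹ : LocalRing L v) • Φv := by rw [← smul_smul, e1]
  have hS : formCongr σ (T₁⁻¹ * T₂) Φv = (σ z * z) • Φv := by
    rw [formCongr_mul_eq, hback, formCongr_smul_eq, h₂, smul_smul, hz]
    congr 1
    rw [mul_comm, mul_assoc, ha₁.mul_val_inv, mul_one]
  -- `u := S · (z • 1)⁻¹` preserves `Φ_N`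
  have hσzi : σ z * z * (σ (↑z⁻¹ : LocalRing L v) * ↑z⁻¹) = 1 := by
    calc σ (z : LocalRing L v) * z * (σ (↑z⁻¹ : LocalRing L v) * ↑z⁻¹)
        = σ ((z : LocalRing L v) * ↑z⁻¹) * ((z : LocalRing L v) * ↑z⁻¹) := by rw [map_mul]; ring
      _ = 1 := by rw [Units.mul_inv, map_one, mul_one]
  set u : GL (Fin N) (LocalRing L v) :=
    T₁⁻¹ * T₂ * (Units.map ((Matrix.scalar (Fin N) : LocalRing L v →+* Matrix (Fin N) (Fin N) (LocalRing L v)) :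
      LocalRing L v →* Matrix (Fin N) (Fin N) (LocalRing L v)) z)⁻¹ with hudef
  have hu : u ∈ «local» L (IsCMField.complexConj L) N (Matrix.of fun i j : Fin N => if i.val + j.val + 1 = N then (1 : L) else 0) v := by
    rw [local_eq_unitaryGroupOfForm_map, mem_unitaryGroupOfForm_iff]
    change formCongr σ u Φv = Φv
    rw [hudef, formCongr_mul_eq, hS, formCongr_smul_eq, ← map_inv, formCongr_scalar_eq_smul, smul_smul, hσzi, one_smul]
  have hSu : T₁⁻¹ * T₂ = u * Units.map ((Matrix.scalar (Fin N) : LocalRing L v →+* Matrix (Fin N) (Fin N) (LocalRing L v)) :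
      LocalRing L v →* Matrix (Fin N) (Fin N) (LocalRing L v)) z := by
    rw [hudef, inv_mul_cancel_right]
  -- `e₂ g = e₁ u' · e₁ g · (e₁ u')⁻¹` with `u' = ⟨u, hu⟩`
  set e₁ := cmDatumLocalCongr L v T₁ ha₁ h₁ with he₁
  set e₂ := cmDatumLocalCongr L v T₂ ha₂ h₂ with he₂
  have hconj : ∀ g : (cmDatum L N (Matrix.of fun i j : Fin N => if i.val + j.val + 1 = N then (1 : L) else 0)).Local v,
      e₂ g = e₁ ⟨u, hu⟩ * e₁ g * (e₁ ⟨u, hu⟩)⁻¹ := by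
    intro g
    rw [← map_mul, ← map_inv, ← map_mul]
    apply Subtype.ext
    rw [coe_cmDatumLocalCongr_apply, coe_cmDatumLocalCongr_apply]
    change T₂ * g.val * T₂⁻¹ = T₁ * (u * g.val * u⁻¹) * T₁⁻¹
    rw [← conj_eq_conj_of_eq_mul_scalar hSu g.val]
    group
  exact (IrrClass.comap_eq_comap_of_forall_eq_conj e₁ e₂ (e₁ ⟨u, hu⟩) hconj c).symm

end Summit.HodgeConjecture.HodgeConjecture.R90.S4

end
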